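import Mathlib.NumberTheory.Padics.Hensel
import Mathlib.NumberTheory.Padics.RingHoms
import Mathlib.RingTheory.ZMod.UnitsCyclic
import Mathlib.Data.ZMod.QuotientGroup
import Mathlib.Analysis.Normed.Ring.Units
import Mathlib.Analysis.SpecificLimits.Normed
import Mathlib.FieldTheory.Finite.Basic
import Mathlib.Topology.Algebra.ContinuousMonoidHom
import HarnessLib

/-!
# `ℤ_p`-valued characters of `p`-adic unit groups (proofs only)

Two elementary facts about continuous (or arbitrary) homomorphisms from the unit groups `ℤ_ℓˣ`
into the additive group `ℤ_p`, used in the Kronecker–Weber reduction of the `ℤ_p`-rank-one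
statement `Hom_cont(Γ_ℚ, ℤ_p) = ℤ_p · κ_cyc` (the `ℚ`-side input of
`Literature.NumberTheory.EllipticCurves.ZpExtension.exists_isAnticyclotomic`, files `ZpExtension*.lean`): every continuous
`Γ_ℚ →ₜ* ℤ_p` factors through `Gal(ℚ(μ_∞)/ℚ) ≃ ∏_ℓ ℤ_ℓˣ`, and on this product

* `Literature.NumberTheory.EllipticCurves.ZpExtension.PadicUnits.addChar_eq_zero_of_ne`: for primes `ℓ ≠ p`, **every** homomorphism
  `ℤ_ℓˣ → ℤ_p` is zero.  Printed architecture (Serre, *A Course in Arithmetic*, Ch. II §3,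
  Prop. 7–8: `ℤ_ℓˣ = V × U₁`, `V ≃ 𝔽_ℓˣ` finite, `U₁ ≃ ℤ_ℓ`): `u^{ℓ-1} ∈ U₁` (Fermat), `U₁` is
  `p`-divisible (Hensel's lemma for `X^p - v`, `p ∈ ℤ_ℓˣ`), so the image of `U₁` lies in
  `⋂ pⁿ ℤ_p = 0`, and `ℤ_p` is torsion-free.
* `Literature.NumberTheory.EllipticCurves.ZpExtension.PadicUnits.dependent`: any two *continuous* homomorphisms `ℤ_pˣ → ℤ_p` are
  `ℤ_p`-linearly dependent (`Hom_cont(ℤ_pˣ, ℤ_p)` has rank `≤ 1`).  Printed architecture (Serre,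
  loc. cit., Lemma and Prop. 8: `U₁/U_n` is cyclic generated by the image of `α = 1 + p` for
  `p ≠ 2`; `U₂ ≃ ℤ₂`): uniformly in `p` we use `γ = 1 + p³`, whose image generates
  `U₃/U_{n+3}` (Mathlib `ZMod.orderOf_one_add_mul_prime_pow` plus a count of
  `ker((ℤ/p^{n+3})ˣ → (ℤ/p³)ˣ)`), so `U₃ = {u ≡ 1 mod p³}` is the closure of `γ^ℕ`; a continuous
  homomorphism vanishing at `γ` vanishes on `U₃`, and `u^{φ(p³)} ∈ U₃` for every unit `u`.

All statements are `theorem`s; there are no new definitions.  Characters are written additively as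
functions `h : ℤ_ℓˣ → ℤ_p` with `h (u v) = h u + h v`, and restated for (continuous) monoid
homomorphisms into `Multiplicative ℤ_[p]`, the format of `Literature.NumberTheory.EllipticCurves.ZpExtension`.

## References

* [Serre1973] J.-P. Serre, *A Course in Arithmetic*, GTM 7, Springer 1973, Ch. II §3.1–3.2,
  Prop. 7, Lemma, Prop. 8 (held copy, PDF pp. 16–17).
* [Washington1997] L. C. Washington, *Introduction to Cyclotomic Fields*, 2nd ed., §13.1 (the
  unique `ℤ_p`-extension of `ℚ`).
-/

noncomputable section

open scoped Topology
open Filter Set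

namespace Literature.NumberTheory.EllipticCurves

namespace ZpExtension

namespace PadicUnits

variable {p : ℕ} [Fact p.Prime]

/-! ### Generalities on `ℤ_p` -/

/-- `⋂ₙ pⁿ ℤ_p = 0`: an element divisible by every power of `p` is `0` (its valuation would be
infinite).  Ref: Serre, *A Course in Arithmetic*, Ch. II §1.2. [folklore] -/
theorem eq_zero_of_forall_pow_dvd {x : ℤ_[p]} (h : ∀ n : ℕ, (p : ℤ_[p]) ^ n ∣ x) : x = 0 := by
  by_contra hx
  have h1 : x ∈ (Ideal.span {(p : ℤ_[p]) ^ (x.valuation + 1)} : Ideal ℤ_[p]) :=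
    Ideal.mem_span_singleton.mpr (h _)
  have h2 := (PadicInt.mem_span_pow_iff_le_valuation x hx _).mp h1
  omega

/-- An additive function `h` on a monoid (`h (u v) = h u + h v`) vanishes at `1`. [folklore] -/
theorem addChar_one {M : Type*} [Monoid M] {A : Type*} [AddGroup A] (h : M → A)
    (hmul : ∀ u v, h (u * v) = h u + h v) : h 1 = 0 := by
  have h1 := hmul 1 1
  rw [mul_one, left_eq_add] at h1
  exact h1

/-- An additive function `h` on a monoid satisfies `h (u ^ k) = k · h u`. [folklore] -/
theorem addChar_pow {M : Type*} [Monoid M] (h : M → ℤ_[p])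
    (hmul : ∀ u v, h (u * v) = h u + h v) (u : M) (k : ℕ) : h (u ^ k) = k * h u := by
  induction k with
  | zero => rw [pow_zero, addChar_one h hmul, Nat.cast_zero, zero_mul]
  | succ k ih => rw [pow_succ, hmul, ih, Nat.cast_succ, add_mul, one_mul]

/-! ### Homomorphisms `ℤ_ℓˣ → ℤ_p`, `ℓ ≠ p`, are trivial -/

/-- **Fermat in `ℤ_ℓ`.**  For a unit `u ∈ ℤ_ℓˣ`, `u^{ℓ-1} ≡ 1 (mod ℓ)`, i.e. `u^{ℓ-1}` is a
principal unit: `‖u^{ℓ-1} - 1‖ < 1`.  Ref: Serre, *A Course in Arithmetic*, Ch. II §3.1,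
Prop. 7 (`U/U₁ ≃ 𝔽_ℓˣ`). [folklore] -/
theorem norm_pow_sub_one_sub_one_lt {ℓ : ℕ} [Fact ℓ.Prime] (u : ℤ_[ℓ]ˣ) :
    ‖(u : ℤ_[ℓ]) ^ (ℓ - 1) - 1‖ < 1 := by
  rw [← PadicInt.mem_nonunits, ← IsLocalRing.mem_maximalIdeal, ← PadicInt.ker_toZMod,
    RingHom.mem_ker, map_sub, map_pow, map_one, sub_eq_zero]
  have hu : (PadicInt.toZMod (u : ℤ_[ℓ]) : ZMod ℓ) ≠ 0 := by
    have h := (Units.map (PadicInt.toZMod : ℤ_[ℓ] →+* ZMod ℓ).toMonoidHom u).ne_zero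
    rwa [Units.coe_map] at h
  exact ZMod.pow_card_sub_one_eq_one hu

/-- **Roots of principal units (Hensel).**  If `n` is prime to `ℓ` then every principal unit
`v ∈ 1 + ℓ ℤ_ℓ` has an `n`-th root which is again a principal unit: apply Hensel's lemma to
`X^n - v` at `a = 1` (`‖1 - v‖ < 1 = ‖n‖²`).  Ref: Serre, *A Course in Arithmetic*, Ch. II §3.2
(proof of Prop. 8: `U₁ ≃ ℤ_ℓ`, on which every integer prime to `ℓ` acts invertibly); Ch. II §2.2
(Hensel). [folklore] -/
theorem exists_pow_eq_of_norm_sub_one_lt {ℓ : ℕ} [Fact ℓ.Prime] {n : ℕ} (hn : ℓ.Coprime n)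
    {v : ℤ_[ℓ]} (hv : ‖v - 1‖ < 1) :
    ∃ z : ℤ_[ℓ], ‖z - 1‖ < 1 ∧ z ^ n = v := by
  have hnorm_n : ‖(n : ℤ_[ℓ])‖ = 1 := PadicInt.norm_natCast_eq_one_iff.mpr hn
  set F : Polynomial ℤ_[ℓ] := Polynomial.X ^ n - Polynomial.C v with hF_def
  have hF : ∀ z : ℤ_[ℓ], Polynomial.aeval z F = z ^ n - v := fun z => by
    simp only [hF_def, map_sub, map_pow, Polynomial.aeval_X, Polynomial.aeval_C,
      Algebra.algebraMap_self, RingHom.id_apply]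
  have hF' : ∀ z : ℤ_[ℓ], Polynomial.aeval z (Polynomial.derivative F) = n * z ^ (n - 1) :=
    fun z => by
    simp only [hF_def, Polynomial.derivative_sub, Polynomial.derivative_X_pow,
      Polynomial.derivative_C, sub_zero, map_mul, map_natCast, map_pow, Polynomial.aeval_X]
  have hnorm : ‖Polynomial.aeval (1 : ℤ_[ℓ]) F‖ <
      ‖Polynomial.aeval (1 : ℤ_[ℓ]) (Polynomial.derivative F)‖ ^ 2 := by
    rw [hF, hF']
    simp only [one_pow, mul_one, hnorm_n]
    rw [← norm_neg, neg_sub]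
    exact hv
  obtain ⟨z, hz0, hz1, -, -⟩ := hensels_lemma hnorm
  refine ⟨z, ?_, ?_⟩
  · simp only [hF', one_pow, mul_one, hnorm_n] at hz1
    exact hz1
  · rw [hF] at hz0
    exact sub_eq_zero.mp hz0

/-- **Homomorphisms `ℤ_ℓˣ → ℤ_p` (`ℓ ≠ p`) are zero.**  Let `h : ℤ_ℓˣ → ℤ_p` be additive
(`h (u v) = h u + h v`; no continuity needed).  Principal units are `p`-divisible
(`exists_pow_eq_of_norm_sub_one_lt`), so `h(U₁) ⊆ pⁿ ℤ_p` for all `n`, i.e. `h(U₁) = 0`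
(`eq_zero_of_forall_pow_dvd`); and `u^{ℓ-1} ∈ U₁` (`norm_pow_sub_one_sub_one_lt`) gives
`(ℓ - 1) · h u = 0`, so `h u = 0` as `ℤ_p` is torsion-free.  Equivalently
`Hom(ℤ_ℓˣ, ℤ_p) = 0`: `ℤ_ℓˣ ≃ 𝔽_ℓˣ × ℤ_ℓ` (resp. `{±1} × ℤ₂`) has no `ℤ_p`-quotient.
Ref: Serre, *A Course in Arithmetic*, Ch. II §3, Prop. 7–8; used in Washington, *Introduction to
Cyclotomic Fields*, §13.1 (a `ℤ_p`-extension is unramified outside `p`). [folklore] -/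
theorem addChar_eq_zero_of_ne {ℓ : ℕ} [Fact ℓ.Prime] (hℓ : ℓ ≠ p) (h : ℤ_[ℓ]ˣ → ℤ_[p])
    (hmul : ∀ u v, h (u * v) = h u + h v) (u : ℤ_[ℓ]ˣ) : h u = 0 := by
  have hp : p.Prime := Fact.out
  have hl : ℓ.Prime := Fact.out
  have hcop : ℓ.Coprime p := (Nat.coprime_primes hl hp).mpr hℓ
  -- `h(U₁) ⊆ pⁿ ℤ_p` for every `n`
  have key : ∀ (n : ℕ) (v : ℤ_[ℓ]ˣ), ‖(v : ℤ_[ℓ]) - 1‖ < 1 → (p : ℤ_[p]) ^ n ∣ h v := by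
    intro n
    induction n with
    | zero => intro v _; rw [pow_zero]; exact one_dvd _
    | succ n ih =>
      intro v hv
      obtain ⟨z, hz1, hzp⟩ := exists_pow_eq_of_norm_sub_one_lt hcop hv
      have hzu : IsUnit z := by
        rw [← isUnit_pow_iff hp.ne_zero, hzp]
        exact Units.isUnit v
      obtain ⟨w, rfl⟩ := hzu
      have hwp : w ^ p = v := Units.ext (by rw [Units.val_pow_eq_pow_val]; exact hzp)
      rw [← hwp, addChar_pow h hmul, pow_succ']
      exact mul_dvd_mul_left _ (ih w hz1)
  have hU1 : ∀ v : ℤ_[ℓ]ˣ, ‖(v : ℤ_[ℓ]) - 1‖ < 1 → h v = 0 := fun v hv =>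
    eq_zero_of_forall_pow_dvd fun n => key n v hv
  -- Fermat: `u^{ℓ-1} ∈ U₁`
  have h1 := hU1 (u ^ (ℓ - 1)) (by rw [Units.val_pow_eq_pow_val]; exact norm_pow_sub_one_sub_one_lt u)
  rw [addChar_pow h hmul] at h1
  have hne : ((ℓ - 1 : ℕ) : ℤ_[p]) ≠ 0 := by
    have h2 := hl.two_le
    have h0 : ℓ - 1 ≠ 0 := by omega
    exact_mod_cast h0
  exact (mul_eq_zero.mp h1).resolve_left hne

/-- **`Hom(ℤ_ℓˣ, ℤ_p) = 0` for `ℓ ≠ p`**, monoid-homomorphism form (values in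
`Multiplicative ℤ_[p]`, the format of `Literature.NumberTheory.EllipticCurves.ZpExtension`).  Ref: Serre, *A Course in Arithmetic*,
Ch. II §3, Prop. 7–8. [folklore] -/
theorem monoidHom_eq_one_of_ne {ℓ : ℕ} [Fact ℓ.Prime] (hℓ : ℓ ≠ p)
    (g : ℤ_[ℓ]ˣ →* Multiplicative ℤ_[p]) : g = 1 := by
  ext u
  have h := addChar_eq_zero_of_ne hℓ (fun u => (g u).toAdd)
    (fun u v => by rw [map_mul, toAdd_mul]) u
  rw [MonoidHom.one_apply, ← ofAdd_toAdd (g u), h, ofAdd_zero]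

/-- **`Hom_cont(ℤ_ℓˣ, ℤ_p) = 0` for `ℓ ≠ p`**, continuous-monoid-homomorphism form.
Ref: Serre, *A Course in Arithmetic*, Ch. II §3, Prop. 7–8. [folklore] -/
theorem continuousMonoidHom_eq_one_of_ne {ℓ : ℕ} [Fact ℓ.Prime] (hℓ : ℓ ≠ p)
    (g : ℤ_[ℓ]ˣ →ₜ* Multiplicative ℤ_[p]) : g = 1 := by
  apply DFunLike.coe_injective
  rw [ContinuousMonoidHom.coe_one]
  funext u
  have h := addChar_eq_zero_of_ne hℓ (fun u => (g u).toAdd)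
    (fun u v => by rw [map_mul, toAdd_mul]) u
  rw [Pi.one_apply, ← ofAdd_toAdd (g u), h, ofAdd_zero]

/-! ### `Hom_cont(ℤ_pˣ, ℤ_p)` has rank at most one -/

/-- `1 + p³` is a unit of `ℤ_p` (`‖p³‖ < 1 = ‖1‖`).  It is the topological generator `γ` of
`U₃ = 1 + p³ ℤ_p` used below (Serre uses `α = 1 + p`, `p ≠ 2`; the exponent `3` makes the
argument uniform in `p`, including `p = 2`).  Ref: Serre, *A Course in Arithmetic*, Ch. II §3.2.
[folklore] -/
theorem isUnit_one_add_prime_pow_three : IsUnit (1 + (p : ℤ_[p]) ^ 3) := by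
  have hp : p.Prime := Fact.out
  rw [PadicInt.isUnit_iff]
  have hlt : ‖(p : ℤ_[p]) ^ 3‖ < ‖(1 : ℤ_[p])‖ := by
    rw [norm_one, norm_pow, PadicInt.norm_p]
    have h1 : (1 : ℝ) < p := by exact_mod_cast hp.one_lt
    exact pow_lt_one₀ (by positivity) (inv_lt_one_of_one_lt₀ h1) three_ne_zero
  have hne : ‖(1 : ℤ_[p])‖ ≠ ‖(p : ℤ_[p]) ^ 3‖ := ne_of_gt hlt
  rw [PadicInt.norm_add_eq_max_of_ne hne, max_eq_left hlt.le, norm_one]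

/-- **`U₃/U_{n+3}` is cyclic, generated by `γ = 1 + p³`** (finite level).  If
`v ≡ 1 (mod p³)` then `v ≡ γ^k (mod p^{n+3})` for some `k`: in `(ℤ/p^{n+3})ˣ` the class of `γ`
has order `pⁿ` (Mathlib `ZMod.orderOf_one_add_mul_prime_pow`), which is the order of the kernel
of `(ℤ/p^{n+3})ˣ → (ℤ/p³)ˣ` (`φ(p^{n+3})/φ(p³)`), so `γ` generates that kernel.
Ref: Serre, *A Course in Arithmetic*, Ch. II §3.2, Lemma and proof of Prop. 8 ("`U₁/U_n` is of
order `p^{n-1}`; hence it is a cyclic group, generated by `α_n`"). [folklore] -/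
theorem exists_pow_toZModPow_eq {γ v : ℤ_[p]ˣ} (hγ : (γ : ℤ_[p]) = 1 + (p : ℤ_[p]) ^ 3)
    (hv : PadicInt.toZModPow 3 (v : ℤ_[p]) = 1) (n : ℕ) :
    ∃ k : ℕ, PadicInt.toZModPow (n + 3) ((γ : ℤ_[p]) ^ k) =
      PadicInt.toZModPow (n + 3) (v : ℤ_[p]) := by
  classical
  have hp : p.Prime := Fact.out
  haveI : NeZero (p ^ (n + 3)) := ⟨pow_ne_zero _ hp.ne_zero⟩
  haveI : NeZero (p ^ 3) := ⟨pow_ne_zero _ hp.ne_zero⟩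
  have h3N : p ^ 3 ∣ p ^ (n + 3) := pow_dvd_pow p (by omega)
  -- the reduction maps and the finite avatars of `γ`, `v`
  let π : (ZMod (p ^ (n + 3)))ˣ →* (ZMod (p ^ 3))ˣ := ZMod.unitsMap h3N
  let red : ℤ_[p]ˣ →* (ZMod (p ^ (n + 3)))ˣ :=
    Units.map (PadicInt.toZModPow (n + 3) : ℤ_[p] →+* ZMod (p ^ (n + 3))).toMonoidHom
  have hred : ∀ w : ℤ_[p]ˣ, ((red w : (ZMod (p ^ (n + 3)))ˣ) : ZMod (p ^ (n + 3))) =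
      PadicInt.toZModPow (n + 3) (w : ℤ_[p]) := fun w => by
    simp only [red, Units.coe_map, RingHom.toMonoidHom_eq_coe, MonoidHom.coe_coe]
  have hcompat : ∀ x : ℤ_[p], (ZMod.castHom h3N (ZMod (p ^ 3))) (PadicInt.toZModPow (n + 3) x) =
      PadicInt.toZModPow 3 x := fun x => by
    rw [← RingHom.comp_apply, PadicInt.zmod_cast_comp_toZModPow 3 (n + 3) (by omega)]
  have hπ : ∀ w : ℤ_[p]ˣ, ((π (red w) : (ZMod (p ^ 3))ˣ) : ZMod (p ^ 3)) =
      PadicInt.toZModPow 3 (w : ℤ_[p]) := fun w => by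
    simp only [π, ZMod.unitsMap_def, Units.coe_map, MonoidHom.coe_coe, hred, hcompat]
  -- `γ̄` and `v̄` lie in the kernel of `π`
  have hp3 : ((p : ZMod (p ^ 3)) ^ 3 : ZMod (p ^ 3)) = 0 := by
    rw [← Nat.cast_pow, ZMod.natCast_self]
  have hγker : red γ ∈ π.ker := by
    rw [MonoidHom.mem_ker]
    apply Units.ext
    rw [hπ, hγ, map_add, map_one, map_pow, map_natCast, hp3, add_zero, Units.val_one]
  have hvker : red v ∈ π.ker := by
    rw [MonoidHom.mem_ker]
    apply Units.ext
    rw [hπ, hv, Units.val_one]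
  -- the order of `γ̄` is `pⁿ`
  have horder : orderOf (red γ) = p ^ n := by
    rw [← orderOf_units, hred, hγ, map_add, map_one, map_pow, map_natCast]
    have h35 : 3 + 2 ≤ p * 3 := by have := hp.two_le; omega
    have ha : ¬ (p : ℤ) ∣ 1 := by
      intro H
      apply hp.ne_one
      simpa using Int.eq_one_of_dvd_one (Int.natCast_nonneg p) H
    have h := ZMod.orderOf_one_add_mul_prime_pow hp 3 three_ne_zero h35 1 ha n
    simpa only [Int.cast_one, mul_one] using h
  -- the kernel of `π` has order `pⁿ`
  have hcardN : Nat.card (ZMod (p ^ (n + 3)))ˣ = p ^ n * (p ^ 2 * (p - 1)) := by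
    rw [Nat.card_eq_fintype_card, ZMod.card_units_eq_totient, Nat.totient_prime_pow hp (by omega)]
    have e : n + 3 - 1 = n + 2 := by omega
    rw [e]; ring
  have hcard3 : Nat.card (ZMod (p ^ 3))ˣ = p ^ 2 * (p - 1) := by
    rw [Nat.card_eq_fintype_card, ZMod.card_units_eq_totient, Nat.totient_prime_pow hp (by omega)]
  have hrange : π.range = ⊤ := MonoidHom.range_eq_top.mpr (ZMod.unitsMap_surjective h3N)
  have hker : Nat.card π.ker = p ^ n := by
    have h1 := π.ker.card_mul_index
    rw [Subgroup.index_ker, hrange, Subgroup.card_top, hcard3, hcardN] at h1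
    have hpos : 0 < p ^ 2 * (p - 1) := by
      have := hp.two_le
      exact Nat.mul_pos (pow_pos hp.pos 2) (by omega)
    exact Nat.eq_of_mul_eq_mul_right hpos h1
  -- hence `γ̄` generates the kernel, which contains `v̄`
  have hzp : Subgroup.zpowers (red γ) = π.ker := by
    haveI : Finite π.ker := inferInstance
    refine Subgroup.eq_of_le_of_card_ge (Subgroup.zpowers_le.mpr hγker) ?_
    rw [hker, Nat.card_zpowers, horder]
  have hvmem : red v ∈ Submonoid.powers (red γ) := by
    rw [mem_powers_iff_mem_zpowers, hzp]
    exact hvker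
  obtain ⟨k, hk⟩ := (Submonoid.mem_powers_iff _ _).mp hvmem
  refine ⟨k, ?_⟩
  have hk' := congrArg (fun w : (ZMod (p ^ (n + 3)))ˣ => (w : ZMod (p ^ (n + 3)))) hk
  simp only [Units.val_pow_eq_pow_val, hred] at hk'
  rw [map_pow]
  exact hk'

/-- **A continuous character vanishing at `γ = 1 + p³` vanishes identically.**  Let
`h : ℤ_pˣ → ℤ_p` be continuous and additive with `h γ = 0`.  Then `h` vanishes on `γ^ℕ`, hence
on its closure, which contains `U₃ = {u ≡ 1 mod p³}` (`exists_pow_toZModPow_eq`: `γ^ℕ` is dense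
in `U₃`); and `u^{φ(p³)} ∈ U₃` for every `u` (Euler), so `φ(p³) · h u = 0` and `h u = 0`
(`ℤ_p` is torsion-free).  Ref: Serre, *A Course in Arithmetic*, Ch. II §3.2, Prop. 8 (`U₁ ≃ ℤ_p`
topologically generated by `1 + p` for `p ≠ 2`, `U₂ ≃ ℤ₂`). [folklore] -/
theorem addChar_eq_zero_of_apply_gen {γ : ℤ_[p]ˣ} (hγ : (γ : ℤ_[p]) = 1 + (p : ℤ_[p]) ^ 3)
    (h : ℤ_[p]ˣ → ℤ_[p]) (hcont : Continuous h) (hmul : ∀ u v, h (u * v) = h u + h v)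
    (h0 : h γ = 0) (u : ℤ_[p]ˣ) : h u = 0 := by
  have hp : p.Prime := Fact.out
  -- Step 1: `h` vanishes on `U₃`
  have hU3 : ∀ v : ℤ_[p]ˣ, PadicInt.toZModPow 3 (v : ℤ_[p]) = 1 → h v = 0 := by
    intro v hv
    have hclosed : IsClosed (h ⁻¹' {0}) := isClosed_singleton.preimage hcont
    have hsub : Set.range (fun k : ℕ => γ ^ k) ⊆ h ⁻¹' {0} := by
      rintro _ ⟨k, rfl⟩
      rw [Set.mem_preimage, Set.mem_singleton_iff, addChar_pow h hmul, h0, mul_zero]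
    have hmem : v ∈ closure (Set.range fun k : ℕ => γ ^ k) := by
      rw [Units.isOpenEmbedding_val.isEmbedding.closure_eq_preimage_closure_image,
        Set.mem_preimage, Metric.mem_closure_iff]
      intro ε hε
      obtain ⟨n, hn⟩ := PadicInt.exists_pow_neg_lt p hε
      obtain ⟨k, hk⟩ := exists_pow_toZModPow_eq hγ hv n
      refine ⟨(γ : ℤ_[p]) ^ k, ⟨γ ^ k, ⟨k, rfl⟩, by rw [Units.val_pow_eq_pow_val]⟩, ?_⟩
      rw [dist_eq_norm]
      have hspan : (v : ℤ_[p]) - (γ : ℤ_[p]) ^ k ∈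
          (Ideal.span {(p : ℤ_[p]) ^ (n + 3)} : Ideal ℤ_[p]) := by
        rw [← PadicInt.ker_toZModPow, RingHom.mem_ker, map_sub, hk, sub_self]
      have h1 : (1 : ℝ) ≤ p := by exact_mod_cast hp.one_lt.le
      calc ‖(v : ℤ_[p]) - (γ : ℤ_[p]) ^ k‖ ≤ (p : ℝ) ^ (-((n + 3 : ℕ) : ℤ)) :=
            (PadicInt.norm_le_pow_iff_mem_span_pow _ _).mpr hspan
        _ ≤ (p : ℝ) ^ (-(n : ℤ)) := zpow_le_zpow_right₀ h1 (by push_cast; omega)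
        _ < ε := hn
    exact hclosed.closure_subset_iff.mpr hsub hmem
  -- Step 2: `u ^ φ(p³) ∈ U₃` (Euler)
  have hq : PadicInt.toZModPow 3 ((u ^ Nat.totient (p ^ 3) : ℤ_[p]ˣ) : ℤ_[p]) = 1 := by
    haveI : NeZero (p ^ 3) := ⟨pow_ne_zero _ hp.ne_zero⟩
    have h1 := ZMod.pow_totient
      (Units.map (PadicInt.toZModPow 3 : ℤ_[p] →+* ZMod (p ^ 3)).toMonoidHom u)
    have h2 := congrArg (fun w : (ZMod (p ^ 3))ˣ => (w : ZMod (p ^ 3))) h1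
    simp only [Units.val_pow_eq_pow_val, Units.coe_map, RingHom.toMonoidHom_eq_coe,
      MonoidHom.coe_coe, Units.val_one] at h2
    rw [Units.val_pow_eq_pow_val, map_pow]
    exact h2
  have h1 := hU3 _ hq
  rw [addChar_pow h hmul] at h1
  have hne : ((Nat.totient (p ^ 3) : ℕ) : ℤ_[p]) ≠ 0 := by
    exact_mod_cast (Nat.totient_pos.mpr (pow_pos hp.pos 3)).ne'
  exact (mul_eq_zero.mp h1).resolve_left hne

/-- **`Hom_cont(ℤ_pˣ, ℤ_p)` has rank at most one.**  Any two continuous homomorphisms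
`g₁, g₂ : ℤ_pˣ → ℤ_p` are `ℤ_p`-linearly dependent: `a g₁ = b g₂` with `(a, b) ≠ (0, 0)`, namely
`a = g₂ γ`, `b = g₁ γ` for the topological generator `γ = 1 + p³` (the combination
`g₂(γ) g₁ - g₁(γ) g₂` vanishes at `γ`, hence everywhere by `addChar_eq_zero_of_apply_gen`; if
`g₁ γ = 0` then `g₁ = 0` and `(a, b) = (1, 0)` works).  Classically: `ℤ_pˣ ≃ μ × ℤ_p`, so
`Hom_cont(ℤ_pˣ, ℤ_p) ≃ ℤ_p`.  Ref: Serre, *A Course in Arithmetic*, Ch. II §3, Thm. 2 and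
Prop. 8; Washington, *Introduction to Cyclotomic Fields*, §13.1. [folklore] -/
theorem dependent (g₁ g₂ : ℤ_[p]ˣ →ₜ* Multiplicative ℤ_[p]) :
    ∃ a b : ℤ_[p], (a ≠ 0 ∨ b ≠ 0) ∧ ∀ u, a * (g₁ u).toAdd = b * (g₂ u).toAdd := by
  obtain ⟨γ, hγ⟩ : ∃ γ : ℤ_[p]ˣ, (γ : ℤ_[p]) = 1 + (p : ℤ_[p]) ^ 3 :=
    ⟨(isUnit_one_add_prime_pow_three (p := p)).unit, IsUnit.unit_spec _⟩
  have hc₁ : Continuous fun u => (g₁ u).toAdd := continuous_toAdd.comp g₁.continuous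
  have hc₂ : Continuous fun u => (g₂ u).toAdd := continuous_toAdd.comp g₂.continuous
  by_cases hb : (g₁ γ).toAdd = 0
  · refine ⟨1, 0, Or.inl one_ne_zero, fun u => ?_⟩
    rw [one_mul, zero_mul]
    exact addChar_eq_zero_of_apply_gen hγ (fun u => (g₁ u).toAdd) hc₁
      (fun u v => by rw [map_mul, toAdd_mul]) hb u
  · refine ⟨(g₂ γ).toAdd, (g₁ γ).toAdd, Or.inr hb, fun u => ?_⟩
    have h := addChar_eq_zero_of_apply_gen hγ
      (fun u => (g₂ γ).toAdd * (g₁ u).toAdd - (g₁ γ).toAdd * (g₂ u).toAdd)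
      ((continuous_const.mul hc₁).sub (continuous_const.mul hc₂))
      (fun u v => by simp only [map_mul, toAdd_mul]; ring) (by ring) u
    exact sub_eq_zero.mp h

end PadicUnits

end ZpExtension

end Literature.NumberTheory.EllipticCurves
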